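/-
COR-CM (cell pub-hodgecm2, stage 2 of the Hodge ladder) — count-neutral KERNEL brick CHAR-TRANSPORT (seat prover-pub-hodgecm2-b07-g35-0,
binder prover b07, gen 35; claim HOME/lit/LIT-STATUS.md 2026-08-21T10:40:53Z, INBOX l.3465).  Theorems only; no definition, no named
fact, nothing asserted; nothing under `CorCM/B01/` is edited; `Interfaces.lean` (C1) untouched.  Proves row C
`Universe.PeriodVectorFullSupport` of the B01 ideation memo IDEA-1g (seat b01-idea-1 gen 7, `HOME/b01/IDEA-1g-Sketch.lean` §1)
AS STATED, for every universe satisfying `Fact_eigenLine` (row M13), by transport of structure along `Aut(ℂ)`.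
-/
import Summits.HodgeConjecture.CorCM.Geometry.WeilLineHodge
import Summits.HodgeConjecture.CorCM.Proofs.Prop22.Multilinear
import Summits.HodgeConjecture.CorCM.Model.PerLConeFacts
import Summits.HodgeConjecture.CorCM.Interfaces
import Summits.HodgeConjecture.CorCM.B01.FaceSupplyAlbanese
import Literature.AlgebraicGeometry.Motives.ZarhinHodgeGroupTransport
import HarnessLib

/-!
# The eigencharacter of the quadrilinear period is idle: transport along `Aut(ℂ)`

The period statements of this cell (`Universe.PeriodNV`, hence `PerL`, `PerL44`, `PeriodThmF = PerLFace`) ask for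
holomorphic one-forms `αᵢ` on the four CM abelian varieties `B_i = A_{(K,Ψᵢ)}` which are eigen for ONE complex embedding
`σ : K → ℂ`, and for `∫_S F₀^*α₀ ∧ F₁^*α₁ ∧ \overline{F₂^*α₂ ∧ F₃^*α₃} ≠ 0`.  We prove that the choice of `σ` is immaterial:

* `Universe.period_pullC_ne_zero_of_eigenLine` — on ANY universe `U` with one-dimensional eigenlines (`Fact_eigenLine`,
  row M13 of `ModelAxioms`; a theorem on the model universe): if `σ`-eigenclasses `αᵢ ∈ H¹(B_i, ℂ)_σ` have non-zero period
  `U.period S (F_i^* αᵢ)`, then so do ANY non-zero `τ`-eigenclasses `βᵢ ∈ H¹(B_i, ℂ)_τ`, for every other embedding `τ`.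
  This is literally row C `PeriodVectorFullSupport` of the ideation memo IDEA-1g (there a displayed hypothesis).
* `Universe.periodNV_of_periodNV_of_forall_mem`, `Universe.periodNV_iff_of_forall_mem` — with the CM-type condition
  (`Fact_alphaLine`, M14): `U.PeriodNV ι₁ V K Ψ σ → U.PeriodNV ι₁ V K Ψ τ` whenever `τ` lies in all four types `Ψᵢ`
  (which is exactly when non-zero holomorphic `τ`-eigenforms exist on all four `B_i`; conversely `PeriodNV … σ` forces
  `σ ∈ Ψᵢ` for all `i`, `Universe.forall_mem_of_periodNV`).
* `Model.periodNV_iff_of_forall_mem`, `Model.period_pullC_ne_zero_of_eigenLine` — the same on the universe of record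
  `Model.picardCMUniverse hHD hI h₁ h₃` (rows M13/M14 are the tree theorems `Model.universeOf_fact_eigenLine/_alphaLine`).

MECHANISM (Deligne, *Hodge cycles on abelian varieties*, LNM 900, I §2–§4: transport of structure by `γ ∈ Aut(ℂ)` on
`H_ℂ = H_ℚ ⊗ ℂ`; here in the abstract universe, where every operation is the base change of a rational one).  For
`σ, τ : K → ℂ` choose `γ ∈ Aut(ℂ)` with `γ ∘ σ = τ` (tree `ZarhinLie.exists_ringEquiv_complex_comp_eq`).  The `γ`-semilinear
map `T = γ ⊗ id` of `H^k(X, ℂ) = ℂ ⊗_ℚ H^k(X, ℚ)` (tree `HodgeStructure.autTensor_*`) commutes with `pullC` and `cup2C` and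
satisfies `trC ∘ T = γ ∘ trC`; it maps the `σ`-eigenline of `H¹(B, ℂ)` into the `γ∘σ`-eigenline, and — `K` being a CM field,
`σ̄ = σ ∘ c_K` for EVERY embedding (`embedding_cmConjRingHom`) — the `σ̄`-eigenline into the `\overline{γ∘σ}`-eigenline, although
`γ` need not commute with complex conjugation.  One-dimensionality of the eigenlines then gives
`period(F^*β) = c · γ(period(F^*α))` with `c ≠ 0`.

References: P. Deligne, *Hodge cycles on abelian varieties* (notes by J. Milne), LNM 900 (1982), I §2 (conjugates `σX`,
`σ ∈ Aut(ℂ)`) and §4 (CM eigenline bookkeeping); G. Shimura, *Abelian Varieties with Complex Multiplication and Modular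
Functions* (1998) §3.2; rfwf v3 Prop. 2.2 / Thm 4.1 and PerL v5 Thm 4.4 for the period shape.
-/

noncomputable section

open scoped TensorProduct
open NumberField NumberField.ComplexEmbedding
open Literature.AlgebraicGeometry.Motives (CMType HodgeStructure)
open Literature.AlgebraicGeometry.Motives.HodgeStructure (conj conj_conj autTensor_tmul autTensor_smul
  autTensor_symm_autTensor autTensor_baseChange)
open Literature.NumberTheory.Automorphic (cmConjRingHom embedding_cmConjRingHom)
open Literature.AlgebraicGeometry.HodgeTheory
open Literature.NumberTheory.Automorphic.PicardCM

namespace Summit.HodgeConjecture.CorCM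

namespace Universe

variable {U : Universe}

/-! ## §1  `γ ⊗ id` on complexified cohomology commutes with the universe's operations -/

section AutC

variable (γ : ℂ ≃+* ℂ)

/-- `γ ⊗ id` commutes with complexified pull-back (both are base changes of rational maps). -/
theorem autC_pullC {X Y : U.Var} (f : U.Mor X Y) (k : ℕ) (x : U.CohC Y k) :
    (γ.toRingHom.toRatAlgHom.toLinearMap.rTensor (U.Coh X k)) (U.pullC f k x) =
      U.pullC f k ((γ.toRingHom.toRatAlgHom.toLinearMap.rTensor (U.Coh Y k)) x) := by
  induction x using TensorProduct.induction_on with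
  | zero => simp
  | tmul z y => rw [pullC_tmul, autTensor_tmul, autTensor_tmul, pullC_tmul]
  | add x y hx hy => rw [map_add, map_add, hx, hy, map_add, map_add]

/-- `γ ⊗ id` is multiplicative for the complexified cup product. -/
theorem autC_cup2C (X : U.Var) (k : ℕ) (x y : U.CohC X k) :
    (γ.toRingHom.toRatAlgHom.toLinearMap.rTensor (U.Coh X (k + k))) (U.cup2C X k x y) =
      U.cup2C X k ((γ.toRingHom.toRatAlgHom.toLinearMap.rTensor (U.Coh X k)) x)
        ((γ.toRingHom.toRatAlgHom.toLinearMap.rTensor (U.Coh X k)) y) := by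
  induction x using TensorProduct.induction_on with
  | zero => simp
  | add a a' ha ha' => simp only [map_add, LinearMap.add_apply, ha, ha']
  | tmul z a =>
    induction y using TensorProduct.induction_on with
    | zero => simp
    | add b b' hb hb' => simp only [map_add, hb, hb']
    | tmul w b => rw [cup2C_tmul, autTensor_tmul, autTensor_tmul, autTensor_tmul, cup2C_tmul, map_mul]

/-- `γ ⊗ id` is multiplicative for the four-fold cup `quadC`. -/
theorem autC_quadC (X : U.Var) (a b c d : U.CohC X 1) :
    (γ.toRingHom.toRatAlgHom.toLinearMap.rTensor (U.Coh X 4)) (U.quadC X a b c d) =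
      U.quadC X ((γ.toRingHom.toRatAlgHom.toLinearMap.rTensor (U.Coh X 1)) a)
        ((γ.toRingHom.toRatAlgHom.toLinearMap.rTensor (U.Coh X 1)) b)
        ((γ.toRingHom.toRatAlgHom.toLinearMap.rTensor (U.Coh X 1)) c)
        ((γ.toRingHom.toRatAlgHom.toLinearMap.rTensor (U.Coh X 1)) d) := by
  show (γ.toRingHom.toRatAlgHom.toLinearMap.rTensor (U.Coh X (2 + 2))) _ = _
  rw [Universe.quadC, autC_cup2C]
  show U.cup2C X 2 ((γ.toRingHom.toRatAlgHom.toLinearMap.rTensor (U.Coh X (1 + 1))) _)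
    ((γ.toRingHom.toRatAlgHom.toLinearMap.rTensor (U.Coh X (1 + 1))) _) = _
  rw [autC_cup2C, autC_cup2C]
  rfl

/-- `γ ⊗ id` twists the complexified trace by `γ` (rational values are fixed by `γ`). -/
theorem autC_trC (X : U.Var) (k : ℕ) (z : U.CohC X k) :
    U.trC X k ((γ.toRingHom.toRatAlgHom.toLinearMap.rTensor (U.Coh X k)) z) = γ (U.trC X k z) := by
  induction z using TensorProduct.induction_on with
  | zero => simp
  | tmul c x => rw [autTensor_tmul, trC_tmul, trC_tmul, Rat.smul_def, Rat.smul_def, map_mul, map_ratCast]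
  | add x y hx hy => rw [map_add, map_add, hx, hy, map_add, map_add]

/-- `γ ⊗ id` is injective (its inverse is `γ⁻¹ ⊗ id`). -/
theorem autC_ne_zero {V : Type*} [AddCommGroup V] [Module ℚ V] {x : ℂ ⊗[ℚ] V} (hx : x ≠ 0) :
    (γ.toRingHom.toRatAlgHom.toLinearMap.rTensor V) x ≠ 0 := by
  intro h
  apply hx
  rw [← autTensor_symm_autTensor γ x, h, map_zero]

/-- `γ ⊗ id` maps the `σ`-eigenline of `H¹(A_{(K,Φ)}, ℂ)` into the `γ ∘ σ`-eigenline (the CM action is rational). -/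
theorem autC_mem_eigenLine {K : CMField} {Φ : CMType K} {σ : K →+* ℂ} {x : U.CohC (U.cmAV K Φ) 1}
    (hx : x ∈ U.eigenLine K Φ σ) :
    (γ.toRingHom.toRatAlgHom.toLinearMap.rTensor (U.Coh (U.cmAV K Φ) 1)) x ∈
      U.eigenLine K Φ (γ.toRingHom.comp σ) := by
  rw [mem_eigenLine_iff] at hx ⊢
  intro e
  rw [← autTensor_baseChange, hx e, autTensor_smul]
  rfl

/-- For a CM field every automorphism of `ℂ` intertwines the conjugate embeddings: `γ ∘ σ̄ = \overline{γ ∘ σ}`, because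
`σ̄ = σ ∘ c_K` with `c_K` the complex conjugation OF `K` (`embedding_cmConjRingHom`). -/
theorem ringEquiv_comp_conjugate (K : CMField) (σ : K →+* ℂ) :
    γ.toRingHom.comp (conjugate σ) = conjugate (γ.toRingHom.comp σ) := by
  ext x
  simp only [RingHom.comp_apply, conjugate_coe_eq]
  rw [← embedding_cmConjRingHom K σ x]
  exact embedding_cmConjRingHom K (γ.toRingHom.comp σ) x

end AutC

/-! ## §2  Eigenlines are lines (`Fact_eigenLine`): comparison of two eigenvectors

(Non-zero vectors in an eigenline: `Universe.exists_mem_eigenLine_ne_zero` of `CorCM/B01/FaceSupplyAlbanese.lean`, imported by name.) -/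

/-- In a one-dimensional eigenline every vector is a multiple of a given non-zero one. -/
theorem exists_eq_smul_of_mem_eigenLine (hE : U.Fact_eigenLine) {K : CMField} {Φ : CMType K} {σ : K →+* ℂ}
    {x y : U.CohC (U.cmAV K Φ) 1} (hx : x ∈ U.eigenLine K Φ σ) (hy : y ∈ U.eigenLine K Φ σ) (hy0 : y ≠ 0) :
    ∃ c : ℂ, x = c • y := by
  have hy0' : (⟨y, hy⟩ : U.eigenLine K Φ σ) ≠ 0 := fun h => hy0 (congrArg Subtype.val h)
  obtain ⟨c, hc⟩ := (finrank_eq_one_iff_of_nonzero' _ hy0').1 (hE K Φ σ) ⟨x, hx⟩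
  exact ⟨c, (congrArg Subtype.val hc).symm⟩

/-! ## §3  The quadrilinear period: slotwise scalars and vanishing -/

/-- The period of pulled-back classes is homogeneous in the four classes, conjugate-linear in the last two. -/
theorem period_pullC_smul {S : U.Var} {K : CMField} {Ψ : Fin 4 → CMType K}
    (Fm : (i : Fin 4) → U.Mor S (U.cmAV K (Ψ i))) (c : Fin 4 → ℂ) (α : (i : Fin 4) → U.CohC (U.cmAV K (Ψ i)) 1) :
    U.period S (fun i => U.pullC (Fm i) 1 (c i • α i)) =
      (c 0 * c 1 * starRingEnd ℂ (c 2) * starRingEnd ℂ (c 3)) * U.period S (fun i => U.pullC (Fm i) 1 (α i)) := by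
  simp only [Universe.period, map_smul, HodgeStructure.conj_smul, quadC_smul, smul_eq_mul]

/-- The period vanishes as soon as one of the four classes does. -/
theorem period_eq_zero_of_apply_eq_zero {S : U.Var} (ω : Fin 4 → U.CohC S 1) {i : Fin 4} (hi : ω i = 0) :
    U.period S ω = 0 := by
  simp only [Universe.period, Universe.quadC]
  fin_cases i <;> simp_all

/-! ## §4  Transport of the period along `Aut(ℂ)` -/

/-- **The period of `(γ ⊗ id)`-transported eigenclasses.**  Let `αᵢ` be NON-ZERO `σ`-eigenclasses and `βᵢ` any
`(γ ∘ σ)`-eigenclasses on the four `A_{(K,Ψᵢ)}`.  Then `period(F^*β) = c · γ (period(F^*α))` for a scalar `c`, which is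
non-zero when all `βᵢ` are non-zero (`βᵢ = cᵢ · (γ ⊗ id) αᵢ` for `i = 0, 1` and `β̄ᵢ = cᵢ · (γ ⊗ id) ᾱᵢ` for `i = 2, 3`). -/
theorem exists_period_pullC_eq_mul_map (hE : U.Fact_eigenLine) (γ : ℂ ≃+* ℂ) {K : CMField} {Ψ : Fin 4 → CMType K}
    {S : U.Var} (Fm : (i : Fin 4) → U.Mor S (U.cmAV K (Ψ i))) {σ : K →+* ℂ}
    {α β : (i : Fin 4) → U.CohC (U.cmAV K (Ψ i)) 1} (hα : ∀ i, α i ∈ U.eigenLine K (Ψ i) σ) (hα0 : ∀ i, α i ≠ 0)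
    (hβ : ∀ i, β i ∈ U.eigenLine K (Ψ i) (γ.toRingHom.comp σ)) :
    ∃ c : ℂ, U.period S (fun i => U.pullC (Fm i) 1 (β i)) = c * γ (U.period S (fun i => U.pullC (Fm i) 1 (α i))) ∧
      ((∀ i, β i ≠ 0) → c ≠ 0) := by
  -- `T = γ ⊗ id` on the four `H¹(A_{Ψᵢ}, ℂ)`
  set Tα : (i : Fin 4) → U.CohC (U.cmAV K (Ψ i)) 1 :=
    fun i => (γ.toRingHom.toRatAlgHom.toLinearMap.rTensor (U.Coh (U.cmAV K (Ψ i)) 1)) (α i) with hTα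
  set Tcα : (i : Fin 4) → U.CohC (U.cmAV K (Ψ i)) 1 :=
    fun i => (γ.toRingHom.toRatAlgHom.toLinearMap.rTensor (U.Coh (U.cmAV K (Ψ i)) 1)) (conj (α i)) with hTcα
  -- slots 0, 1: `βᵢ` and `T αᵢ` lie on the line `H¹_{γσ}`
  have h01 : ∀ i, ∃ c : ℂ, β i = c • Tα i := fun i =>
    exists_eq_smul_of_mem_eigenLine hE (hβ i) (autC_mem_eigenLine γ (hα i)) (autC_ne_zero γ (hα0 i))
  -- slots 2, 3: `conj βᵢ` and `T (conj αᵢ)` lie on the line `H¹_{\overline{γσ}}`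
  have h23 : ∀ i, ∃ c : ℂ, conj (β i) = c • Tcα i := by
    intro i
    have h1 : conj (β i) ∈ U.eigenLine K (Ψ i) (conjugate (γ.toRingHom.comp σ)) := U.conj_mem_eigenLine K (Ψ i) _ (hβ i)
    have h2 : Tcα i ∈ U.eigenLine K (Ψ i) (conjugate (γ.toRingHom.comp σ)) := by
      rw [← ringEquiv_comp_conjugate]
      exact autC_mem_eigenLine γ (U.conj_mem_eigenLine K (Ψ i) σ (hα i))
    have h3 : Tcα i ≠ 0 := autC_ne_zero γ (fun h => hα0 i (by rw [← conj_conj (α i), h, map_zero]))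
    exact exists_eq_smul_of_mem_eigenLine hE h1 h2 h3
  choose c hc using h01
  choose d hd using h23
  refine ⟨c 0 * c 1 * d 2 * d 3, ?_, ?_⟩
  · -- expand the period of `β`
    have eβ : U.period S (fun i => U.pullC (Fm i) 1 (β i)) =
        U.trC S 4 (U.quadC S (U.pullC (Fm 0) 1 (β 0)) (U.pullC (Fm 1) 1 (β 1))
          (U.pullC (Fm 2) 1 (conj (β 2))) (U.pullC (Fm 3) 1 (conj (β 3)))) := by
      simp only [Universe.period, conj_pullC]
    have eα : U.period S (fun i => U.pullC (Fm i) 1 (α i)) =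
        U.trC S 4 (U.quadC S (U.pullC (Fm 0) 1 (α 0)) (U.pullC (Fm 1) 1 (α 1))
          (U.pullC (Fm 2) 1 (conj (α 2))) (U.pullC (Fm 3) 1 (conj (α 3)))) := by
      simp only [Universe.period, conj_pullC]
    rw [eβ, eα, hc 0, hc 1, hd 2, hd 3]
    simp only [map_smul, quadC_smul, smul_eq_mul, hTα, hTcα]
    rw [← autC_pullC, ← autC_pullC, ← autC_pullC, ← autC_pullC, ← autC_quadC, autC_trC]
  · intro hβ0
    have hc0 : ∀ i, c i ≠ 0 := fun i h => hβ0 i (by rw [hc i, h, zero_smul])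
    have hd0 : ∀ i, d i ≠ 0 := fun i h => hβ0 i (by rw [← conj_conj (β i), hd i, h, zero_smul, map_zero])
    exact mul_ne_zero (mul_ne_zero (mul_ne_zero (hc0 0) (hc0 1)) (hd0 2)) (hd0 3)

/-- **Row C `PeriodVectorFullSupport` of IDEA-1g, for every universe with `Fact_eigenLine`.**  For a variety `S` mapping to
four CM abelian varieties `A_{(K,Ψᵢ)}`, the non-vanishing of the period `∫_S F₀^*α₀ ∧ F₁^*α₁ ∧ \overline{F₂^*α₂ ∧ F₃^*α₃}` of
eigenclasses does not depend on the eigencharacter: non-zero for SOME `σ`-eigenclasses `αᵢ` ⇒ non-zero for ALL non-zero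
`τ`-eigenclasses `βᵢ`, for every embedding `τ : K → ℂ`.  (Transport along `γ ∈ Aut(ℂ)` with `γ ∘ σ = τ`.) -/
theorem period_pullC_ne_zero_of_eigenLine (hE : U.Fact_eigenLine) (K : CMField) (Ψ : Fin 4 → CMType K) (S : U.Var)
    (Fm : (i : Fin 4) → U.Mor S (U.cmAV K (Ψ i))) (σ τ : K →+* ℂ) (α β : (i : Fin 4) → U.CohC (U.cmAV K (Ψ i)) 1)
    (hα : ∀ i, α i ∈ U.eigenLine K (Ψ i) σ) (hβ : ∀ i, β i ∈ U.eigenLine K (Ψ i) τ) (hβ0 : ∀ i, β i ≠ 0)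
    (h : U.period S (fun i => U.pullC (Fm i) 1 (α i)) ≠ 0) :
    U.period S (fun i => U.pullC (Fm i) 1 (β i)) ≠ 0 := by
  haveI : Countable K := Countable.of_equiv _ (Module.finBasis ℚ K).equivFun.toEquiv.symm
  obtain ⟨γ, hγ⟩ := Literature.AlgebraicGeometry.Motives.ZarhinLie.exists_ringEquiv_complex_comp_eq σ τ
  have hγ' : γ.toRingHom.comp σ = τ := RingHom.ext hγ
  have hα0 : ∀ i, α i ≠ 0 := fun i h0 =>
    h (period_eq_zero_of_apply_eq_zero _ (i := i) (by simp only [h0, map_zero]))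
  subst hγ'
  obtain ⟨c, hc, hc0⟩ := exists_period_pullC_eq_mul_map hE γ Fm hα hα0 hβ
  rw [hc]
  exact mul_ne_zero (hc0 hβ0) ((map_ne_zero γ).2 h)

/-- The existential form: "some `σ`-eigenclasses have non-zero period" is independent of `σ`. -/
theorem exists_period_pullC_ne_zero_iff (hE : U.Fact_eigenLine) {K : CMField} {Ψ : Fin 4 → CMType K} {S : U.Var}
    (Fm : (i : Fin 4) → U.Mor S (U.cmAV K (Ψ i))) (σ τ : K →+* ℂ) :
    (∃ α : (i : Fin 4) → U.CohC (U.cmAV K (Ψ i)) 1,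
        (∀ i, α i ∈ U.eigenLine K (Ψ i) σ) ∧ U.period S (fun i => U.pullC (Fm i) 1 (α i)) ≠ 0) ↔
      ∃ β : (i : Fin 4) → U.CohC (U.cmAV K (Ψ i)) 1,
        (∀ i, β i ∈ U.eigenLine K (Ψ i) τ) ∧ U.period S (fun i => U.pullC (Fm i) 1 (β i)) ≠ 0 := by
  have key : ∀ (σ τ : K →+* ℂ), (∃ α : (i : Fin 4) → U.CohC (U.cmAV K (Ψ i)) 1,
      (∀ i, α i ∈ U.eigenLine K (Ψ i) σ) ∧ U.period S (fun i => U.pullC (Fm i) 1 (α i)) ≠ 0) →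
      ∃ β : (i : Fin 4) → U.CohC (U.cmAV K (Ψ i)) 1,
        (∀ i, β i ∈ U.eigenLine K (Ψ i) τ) ∧ U.period S (fun i => U.pullC (Fm i) 1 (β i)) ≠ 0 := by
    intro σ τ ⟨α, hα, h⟩
    have hβ : ∀ i, ∃ y ∈ U.eigenLine K (Ψ i) τ, y ≠ 0 := fun i => exists_mem_eigenLine_ne_zero hE K (Ψ i) τ
    choose β hβ hβ0 using hβ
    exact ⟨β, hβ, period_pullC_ne_zero_of_eigenLine hE K Ψ S Fm σ τ α β hα hβ hβ0 h⟩
  exact ⟨key σ τ, key τ σ⟩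

/-! ## §5  `PeriodNV`: the eigen-embedding binder is idle (`Fact_eigenLine`, `Fact_alphaLine`) -/

/-- `PeriodNV … σ` forces `σ` to lie in all four CM types (a non-zero HOLOMORPHIC `σ`-eigenform on `A_{(K,Ψᵢ)}` exists only for
`σ ∈ Ψᵢ`: `Fact_alphaLine`). -/
theorem forall_mem_of_periodNV (hA : U.Fact_alphaLine) {L : CMField} {ι₁ : L →+* ℂ} {V : HermSpace3 L ι₁} {K : CMField}
    {Ψ : Fin 4 → CMType K} {σ : K →+* ℂ} (h : U.PeriodNV ι₁ V K Ψ σ) : ∀ i, σ ∈ (Ψ i).1 := by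
  obtain ⟨Γ, F, α, hα, hper⟩ := h
  intro i
  by_contra hσ
  have h0 : α i = 0 := by
    have := hα i
    rw [(hA K (Ψ i) σ).2 hσ] at this
    exact (Submodule.mem_bot ℂ).1 this
  exact hper (period_eq_zero_of_apply_eq_zero _ (i := i) (by simp only [h0, map_zero]))

/-- **Character transport for `PeriodNV`.**  On a universe with `Fact_eigenLine` (M13) and `Fact_alphaLine` (M14): if the period
datum `(Γ, F, α)` exists with `σ`-eigenforms, it exists — same level, same morphisms — with `τ`-eigenforms, for every `τ` in all
four types `Ψᵢ`. -/
theorem periodNV_of_periodNV_of_forall_mem (hE : U.Fact_eigenLine) (hA : U.Fact_alphaLine) {L : CMField} {ι₁ : L →+* ℂ}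
    {V : HermSpace3 L ι₁} {K : CMField} {Ψ : Fin 4 → CMType K} {σ τ : K →+* ℂ} (hτ : ∀ i, τ ∈ (Ψ i).1)
    (h : U.PeriodNV ι₁ V K Ψ σ) : U.PeriodNV ι₁ V K Ψ τ := by
  obtain ⟨Γ, F, α, hα, hper⟩ := h
  have hβ : ∀ i, ∃ y ∈ U.eigenLine K (Ψ i) τ, y ≠ 0 := fun i => exists_mem_eigenLine_ne_zero hE K (Ψ i) τ
  choose β hβ hβ0 using hβ
  refine ⟨Γ, F, β, fun i => ?_, period_pullC_ne_zero_of_eigenLine hE K Ψ _ F σ τ α β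
    (fun i => alphaLine_le_eigenLine (U := U) K (Ψ i) σ (hα i)) hβ hβ0 hper⟩
  rw [(hA K (Ψ i) τ).1 (hτ i)]
  exact hβ i

/-- **`PeriodNV` does not depend on the eigen-embedding** among the embeddings lying in all four types. -/
theorem periodNV_iff_of_forall_mem (hE : U.Fact_eigenLine) (hA : U.Fact_alphaLine) {L : CMField} {ι₁ : L →+* ℂ}
    {V : HermSpace3 L ι₁} {K : CMField} {Ψ : Fin 4 → CMType K} {σ τ : K →+* ℂ} (hσ : ∀ i, σ ∈ (Ψ i).1)
    (hτ : ∀ i, τ ∈ (Ψ i).1) : U.PeriodNV ι₁ V K Ψ σ ↔ U.PeriodNV ι₁ V K Ψ τ :=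
  ⟨periodNV_of_periodNV_of_forall_mem hE hA hτ, periodNV_of_periodNV_of_forall_mem hE hA hσ⟩

/-- `PeriodNV … σ` holds iff `σ` lies in all four types and `PeriodNV … τ` holds for some (any) `τ` lying in all four types. -/
theorem periodNV_iff_forall_mem_and (hE : U.Fact_eigenLine) (hA : U.Fact_alphaLine) {L : CMField} {ι₁ : L →+* ℂ}
    {V : HermSpace3 L ι₁} {K : CMField} {Ψ : Fin 4 → CMType K} {σ τ : K →+* ℂ} (hτ : ∀ i, τ ∈ (Ψ i).1) :
    U.PeriodNV ι₁ V K Ψ σ ↔ (∀ i, σ ∈ (Ψ i).1) ∧ U.PeriodNV ι₁ V K Ψ τ :=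
  ⟨fun h => ⟨forall_mem_of_periodNV hA h, periodNV_of_periodNV_of_forall_mem hE hA hτ h⟩,
    fun h => periodNV_of_periodNV_of_forall_mem hE hA h.1 h.2⟩

/-- **The face period theorem with a free eigen-embedding.**  `PeriodThmF` (eigenforms at the admissible `ι₁`) is equivalent
to asking, for each datum, for a non-zero period at SOME embedding `σ` (then `σ ∈ Ψᵢ` for all `i` automatically). -/
theorem periodThmF_iff_exists_embedding (hE : U.Fact_eigenLine) (hA : U.Fact_alphaLine) :
    U.PeriodThmF ↔ ∀ (F : CMField), IsGalois ℚ F → 6 ≤ Module.finrank ℚ F →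
      ∀ (f : Face F) (ι₁ : F →+* ℂ), f.Admissible ι₁ →
      ∀ V : HermSpace3 F ι₁, ∃ σ : F →+* ℂ, U.PeriodNV ι₁ V F f.psi σ := by
  refine ⟨fun h F hG h6 f ι₁ hι V => ⟨ι₁, h F hG h6 f ι₁ hι V⟩, fun h F hG h6 f ι₁ hι V => ?_⟩
  obtain ⟨σ, hσ⟩ := h F hG h6 f ι₁ hι V
  exact periodNV_of_periodNV_of_forall_mem hE hA (admissible_mem_psi f ι₁ hι) hσ

end Universe

/-! ## §6  The universe of record (rows M13 `Fact_eigenLine`, M14 `Fact_alphaLine` are tree theorems) -/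

namespace Model

/-- **Row C holds on the model universe `universeOf hHD hI hU h₃`** (M13 = `universeOf_fact_eigenLine`). -/
theorem universeOf_period_pullC_ne_zero_of_eigenLine (hHD : exists_isReal_hodgeModel)
    (hI : hodgePQ_independent_of_hodgeModel) (hU : BallQuotientUniformisedDatum) (h₃ : CMAbelianVarietyRealised)
    (K : CMField) (Ψ : Fin 4 → CMType K) (S : (universeOf hHD hI hU h₃).Var)
    (Fm : (i : Fin 4) → (universeOf hHD hI hU h₃).Mor S ((universeOf hHD hI hU h₃).cmAV K (Ψ i))) (σ τ : K →+* ℂ)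
    (α β : (i : Fin 4) → (universeOf hHD hI hU h₃).CohC ((universeOf hHD hI hU h₃).cmAV K (Ψ i)) 1)
    (hα : ∀ i, α i ∈ (universeOf hHD hI hU h₃).eigenLine K (Ψ i) σ)
    (hβ : ∀ i, β i ∈ (universeOf hHD hI hU h₃).eigenLine K (Ψ i) τ) (hβ0 : ∀ i, β i ≠ 0)
    (h : (universeOf hHD hI hU h₃).period S (fun i => (universeOf hHD hI hU h₃).pullC (Fm i) 1 (α i)) ≠ 0) :
    (universeOf hHD hI hU h₃).period S (fun i => (universeOf hHD hI hU h₃).pullC (Fm i) 1 (β i)) ≠ 0 :=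
  Universe.period_pullC_ne_zero_of_eigenLine (universeOf_fact_eigenLine hHD hI hU h₃) K Ψ S Fm σ τ α β hα hβ hβ0 h

/-- **Row C holds on the universe of record `picardCMUniverse hHD hI h₁ h₃`.** -/
theorem period_pullC_ne_zero_of_eigenLine (hHD : exists_isReal_hodgeModel) (hI : hodgePQ_independent_of_hodgeModel)
    (h₁ : BallQuotientUniformised) (h₃ : CMAbelianVarietyRealised)
    (K : CMField) (Ψ : Fin 4 → CMType K) (S : (picardCMUniverse hHD hI h₁ h₃).Var)
    (Fm : (i : Fin 4) → (picardCMUniverse hHD hI h₁ h₃).Mor S ((picardCMUniverse hHD hI h₁ h₃).cmAV K (Ψ i)))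
    (σ τ : K →+* ℂ) (α β : (i : Fin 4) → (picardCMUniverse hHD hI h₁ h₃).CohC ((picardCMUniverse hHD hI h₁ h₃).cmAV K (Ψ i)) 1)
    (hα : ∀ i, α i ∈ (picardCMUniverse hHD hI h₁ h₃).eigenLine K (Ψ i) σ)
    (hβ : ∀ i, β i ∈ (picardCMUniverse hHD hI h₁ h₃).eigenLine K (Ψ i) τ) (hβ0 : ∀ i, β i ≠ 0)
    (h : (picardCMUniverse hHD hI h₁ h₃).period S (fun i => (picardCMUniverse hHD hI h₁ h₃).pullC (Fm i) 1 (α i)) ≠ 0) :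
    (picardCMUniverse hHD hI h₁ h₃).period S (fun i => (picardCMUniverse hHD hI h₁ h₃).pullC (Fm i) 1 (β i)) ≠ 0 :=
  universeOf_period_pullC_ne_zero_of_eigenLine hHD hI _ h₃ K Ψ S Fm σ τ α β hα hβ hβ0 h

/-- **`PeriodNV` is independent of the eigen-embedding on the model universe `universeOf hHD hI hU h₃`** (M13, M14). -/
theorem universeOf_periodNV_iff_of_forall_mem (hHD : exists_isReal_hodgeModel) (hI : hodgePQ_independent_of_hodgeModel)
    (hU : BallQuotientUniformisedDatum) (h₃ : CMAbelianVarietyRealised) {L : CMField} {ι₁ : L →+* ℂ} (V : HermSpace3 L ι₁)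
    {K : CMField} (Ψ : Fin 4 → CMType K) {σ τ : K →+* ℂ} (hσ : ∀ i, σ ∈ (Ψ i).1) (hτ : ∀ i, τ ∈ (Ψ i).1) :
    (universeOf hHD hI hU h₃).PeriodNV ι₁ V K Ψ σ ↔ (universeOf hHD hI hU h₃).PeriodNV ι₁ V K Ψ τ :=
  Universe.periodNV_iff_of_forall_mem (universeOf_fact_eigenLine hHD hI hU h₃) (universeOf_fact_alphaLine hHD hI hU h₃) hσ hτ

/-- **`PeriodNV` is independent of the eigen-embedding on the universe of record `picardCMUniverse hHD hI h₁ h₃`.** -/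
theorem periodNV_iff_of_forall_mem (hHD : exists_isReal_hodgeModel) (hI : hodgePQ_independent_of_hodgeModel)
    (h₁ : BallQuotientUniformised) (h₃ : CMAbelianVarietyRealised) {L : CMField} {ι₁ : L →+* ℂ} (V : HermSpace3 L ι₁)
    {K : CMField} (Ψ : Fin 4 → CMType K) {σ τ : K →+* ℂ} (hσ : ∀ i, σ ∈ (Ψ i).1) (hτ : ∀ i, τ ∈ (Ψ i).1) :
    (picardCMUniverse hHD hI h₁ h₃).PeriodNV ι₁ V K Ψ σ ↔ (picardCMUniverse hHD hI h₁ h₃).PeriodNV ι₁ V K Ψ τ :=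
  universeOf_periodNV_iff_of_forall_mem hHD hI _ h₃ V Ψ hσ hτ

/-- On the universe of record, `PeriodNV … σ` transports to every `τ` lying in all four types. -/
theorem periodNV_of_periodNV_of_forall_mem (hHD : exists_isReal_hodgeModel) (hI : hodgePQ_independent_of_hodgeModel)
    (h₁ : BallQuotientUniformised) (h₃ : CMAbelianVarietyRealised) {L : CMField} {ι₁ : L →+* ℂ} (V : HermSpace3 L ι₁)
    {K : CMField} (Ψ : Fin 4 → CMType K) {σ τ : K →+* ℂ} (hτ : ∀ i, τ ∈ (Ψ i).1)
    (h : (picardCMUniverse hHD hI h₁ h₃).PeriodNV ι₁ V K Ψ σ) : (picardCMUniverse hHD hI h₁ h₃).PeriodNV ι₁ V K Ψ τ :=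
  Universe.periodNV_of_periodNV_of_forall_mem (universeOf_fact_eigenLine hHD hI _ h₃) (universeOf_fact_alphaLine hHD hI _ h₃)
    hτ h

/-- **`PerLFace` of the universe of record with a free eigen-embedding**: it suffices to produce, for each face datum, a
non-zero period at SOME embedding `σ`. -/
theorem perLFace_iff_exists_embedding (hHD : exists_isReal_hodgeModel) (hI : hodgePQ_independent_of_hodgeModel)
    (h₁ : BallQuotientUniformised) (h₃ : CMAbelianVarietyRealised) :
    (picardCMUniverse hHD hI h₁ h₃).PerLFace ↔ ∀ (F : CMField), IsGalois ℚ F → 6 ≤ Module.finrank ℚ F →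
      ∀ (f : Face F) (ι₁ : F →+* ℂ), f.Admissible ι₁ →
      ∀ V : HermSpace3 F ι₁, ∃ σ : F →+* ℂ, (picardCMUniverse hHD hI h₁ h₃).PeriodNV ι₁ V F f.psi σ :=
  Universe.periodThmF_iff_exists_embedding (universeOf_fact_eigenLine hHD hI _ h₃) (universeOf_fact_alphaLine hHD hI _ h₃)

end Model

end Summit.HodgeConjecture.CorCM

end
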